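import Mathlib.GroupTheory.SpecificGroups.Cyclic
import Mathlib.GroupTheory.Perm.Cycle.Type
import Mathlib.NumberTheory.Padics.PadicVal.Basic
import Mathlib.Data.ZMod.QuotientGroup
import HarnessLib

/-!
# Divisibility exponents in a finite abelian group with cyclic `p`-Sylow subgroup: the largest `j` with
# `x ∈ p^j G` is `v_p #G − v_p(ord x)` (pure group theory behind the `v_ℓ(P)` of the cell conjecture C-16)

HONEST FRAMING (cell `b2b-bsdres`, run/shared/lean/b2b/bsd-rank1-residual/, verbatim in every
file): the goal of the cell is to DELETE the COMBINATION-SHAPED residual classes of the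
Birch–Swinnerton-Dyer formula for ALL analytic-rank `≤ 1` elliptic curves over `ℚ` — "full BSD
formula for every rank `≤ 1` curve in class `C`" assembled STRICTLY from published theorems — so
that the rank-`≤ 1` remainder becomes exactly the CONSTRUCTION-SHAPED classes, which are TYPED
(missing-input `Prop`s), NOT attempted. This is not "finishing BSD". Seat `b2b-bsdres-additive-p3`
(typer-designate for the cell conjecture C-16, hyp R-16 (e)). THEOREMS ONLY about finite abelian groups (Mathlib
imports only); nothing about any curve is asserted, nothing is booked, no mark / label / count / tier
moves; C-16 stays a CONJECTURE (data-suggested, never theorem). Consumer: the sibling file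
`Ordinary/LocalDivExponentPointOrder.lean`, which reads these on `Ẽ(𝔽_ℓ)` to prove that C-16's typed
`localDivExponent W p ℓ P` (`Ordinary/KuriharaExactOrderVocabulary.lean`) is the P-5 instruments'
"ONE point multiplication mod `ℓ`" value `e_ℓ − v_p(ord P̄)` at a cyclic Kolyvagin prime
(hyp `SHARPENED-CONJECTURES.md` §120 C120.1; additive-p3 `R1-DEPTH-LAW.md` §1).

## What is proved (`G` finite abelian, `p` prime, `e = v_p #G`)

* §1: `x = p^j • y`, `j ≤ e` ⟹ `v_p(ord x) + j ≤ e` (`(p^{e−j} m) • x = #G • y = 0` for `#G = p^e m`,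
  `p ∤ m`); hence the divisibility exponent `max {j ≤ e : x ∈ p^j G}` is `≤ e − v_p(ord x)` — no
  cyclicity needed (`findGreatest_pow_smul_add_padicValNat_addOrderOf_le`).
* §1b (`#G[p] ≤ p`, i.e. the `p`-Sylow subgroup is cyclic): `#G[p^i] ≤ p^i` (multiplication by `p` maps
  `G[p^{i+1}]` to `G[p^i]` with kernel inside `G[p]`); `#G[p^e] = p^e` (`#G = #G[p^e] · #(p^e G)` and
  `p ∤ #(p^e G)` by §1 + Cauchy); so `G[p^e] = ℤ·w` with `ord w = p^e`; and then
  `v_p(ord x) + j ≤ e ⟹ x ∈ p^j G` (`b • x ∈ ℤ·w` for `ord x = p^v b`, read off `w`; Bézout for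
  `gcd(b, p^j) = 1`): the divisibility exponent is EXACTLY `e − v_p(ord x)`
  (`findGreatest_pow_smul_eq_sub_padicValNat_addOrderOf`).

References: standard (Sylow / cyclic groups); J. H. Silverman, AEC 2nd ed. (2009), VII.2–VII.3 for the
use on `Ẽ(𝔽_ℓ)` [SilvermanAEC2009].
-/

noncomputable section

open scoped Classical

namespace Summit.BirchSwinnertonDyer.Rank1Residual.Ordinary

/-! ### §1 Finite abelian groups: `p^j`-divisibility bounds the `p`-part of the order -/

section Group

variable {G : Type*} [AddCommGroup G] [Finite G] {p : ℕ} [hp : Fact p.Prime]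

/-- In a finite abelian group of order `p^e · m` (`p ∤ m`): if `x = p^j • y` with `j ≤ e`, then
`v_p(ord x) + j ≤ e` — because `(p^{e−j} m) • x = (p^e m) • y = 0`. [folklore] -/
theorem padicValNat_addOrderOf_add_le_of_pow_smul_eq {j : ℕ} {x y : G}
    (hj : j ≤ padicValNat p (Nat.card G)) (h : p ^ j • y = x) :
    padicValNat p (addOrderOf x) + j ≤ padicValNat p (Nat.card G) := by
  set n := Nat.card G with hn
  set e := padicValNat p n with he
  have hn0 : n ≠ 0 := Nat.card_pos.ne'
  obtain ⟨m, hm⟩ : p ^ e ∣ n := pow_padicValNat_dvd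
  have hm0 : m ≠ 0 := by
    rintro rfl
    exact hn0 (by rw [hm, mul_zero])
  have hpm : ¬ p ∣ m := by
    intro hpm
    have hdiv : p ^ (e + 1) ∣ n := by
      rw [hm, pow_succ]
      exact mul_dvd_mul_left _ hpm
    exact pow_succ_padicValNat_not_dvd hn0 hdiv
  have hprod : p ^ (e - j) * m * p ^ j = n := by
    rw [hm, mul_assoc, mul_comm m, ← mul_assoc, ← pow_add, Nat.sub_add_cancel hj]
  have hkill : (p ^ (e - j) * m) • x = 0 := by
    rw [← h, smul_smul, hprod]
    exact card_nsmul_eq_zero'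
  have hdvd : addOrderOf x ∣ p ^ (e - j) * m := addOrderOf_dvd_of_nsmul_eq_zero hkill
  have hne : p ^ (e - j) * m ≠ 0 := mul_ne_zero (pow_ne_zero _ hp.out.ne_zero) hm0
  have hval : padicValNat p (p ^ (e - j) * m) = e - j := by
    rw [padicValNat.mul (pow_ne_zero _ hp.out.ne_zero) hm0, padicValNat.prime_pow,
      padicValNat.eq_zero_of_not_dvd hpm, add_zero]
  have hle : padicValNat p (addOrderOf x) ≤ e - j := by
    rw [← hval, ← padicValNat_dvd_iff_le hne]
    exact pow_padicValNat_dvd.trans hdvd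
  omega

/-- Hence the largest `j ≤ e = v_p #G` with `x ∈ p^j G` satisfies `j + v_p(ord x) ≤ e`: the
divisibility exponent of `x` is AT MOST `e − v_p(ord x)` (with equality when the `p`-Sylow subgroup
is cyclic, §1b). [folklore] -/
theorem findGreatest_pow_smul_add_padicValNat_addOrderOf_le (x : G) :
    Nat.findGreatest (fun j => ∃ y : G, p ^ j • y = x) (padicValNat p (Nat.card G)) +
      padicValNat p (addOrderOf x) ≤ padicValNat p (Nat.card G) := by
  set j := Nat.findGreatest (fun j => ∃ y : G, p ^ j • y = x) (padicValNat p (Nat.card G)) with hj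
  have hjle : j ≤ padicValNat p (Nat.card G) := Nat.findGreatest_le _
  obtain ⟨y, hy⟩ : ∃ y : G, p ^ j • y = x :=
    Nat.findGreatest_spec (P := fun j => ∃ y : G, p ^ j • y = x) (Nat.zero_le _)
      ⟨x, by rw [pow_zero, one_smul]⟩
  have h := padicValNat_addOrderOf_add_le_of_pow_smul_eq hjle hy
  omega

end Group

/-! ### §1b The cyclic case: `#G[p] ≤ p` makes the bound an equality -/

section Cyclic

variable {G : Type*} [AddCommGroup G] {p : ℕ}

/-- Membership in `G[n] = ker (n • ·)` (the subgroup `(DistribSMul.toAddMonoidHom G n).ker`).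
[folklore] -/
private theorem mem_tors {n : ℕ} {x : G} : x ∈ (DistribSMul.toAddMonoidHom G n).ker ↔ n • x = 0 :=
  Iff.rfl

variable [Finite G]

/-- `#G[p^{i+1}] ≤ p · #G[p^i]`: multiplication by `p` maps `G[p^{i+1}]` to `G[p^i]` with kernel inside
`G[p]`. [folklore] -/
private theorem card_tors_succ_le (hcyc : Nat.card {x : G // p • x = 0} ≤ p) (i : ℕ) :
    Nat.card ((DistribSMul.toAddMonoidHom G (p ^ (i + 1))).ker) ≤
      p * Nat.card ((DistribSMul.toAddMonoidHom G (p ^ i)).ker) := by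
  let φ : (DistribSMul.toAddMonoidHom G (p ^ (i + 1))).ker →+
      (DistribSMul.toAddMonoidHom G (p ^ i)).ker :=
    { toFun := fun x => ⟨p • (x : G), by
        have hx : p ^ (i + 1) • (x : G) = 0 := mem_tors.mp x.2
        rw [mem_tors, smul_smul, ← pow_succ, hx]⟩
      map_zero' := by ext; simp
      map_add' := fun x y => by ext; simp [smul_add] }
  have hkerφ : ∀ x : (DistribSMul.toAddMonoidHom G (p ^ (i + 1))).ker,
      x ∈ φ.ker ↔ p • (x : G) = 0 := fun x => by
    rw [AddMonoidHom.mem_ker]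
    exact ⟨fun h => congrArg Subtype.val h, fun h => Subtype.ext h⟩
  have hker : Nat.card φ.ker ≤ p := by
    refine le_trans (Nat.card_le_card_of_injective
      (fun x : φ.ker =>
        (⟨((x : (DistribSMul.toAddMonoidHom G (p ^ (i + 1))).ker) : G), (hkerφ _).mp x.2⟩ :
          {x : G // p • x = 0}))
      ?_) hcyc
    intro a b h
    simp only [Subtype.mk.injEq] at h
    exact Subtype.ext (Subtype.ext h)
  have h1 : Nat.card ((DistribSMul.toAddMonoidHom G (p ^ (i + 1))).ker) =
      Nat.card φ.ker * Nat.card φ.range := by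
    rw [φ.ker.card_eq_card_quotient_mul_card_addSubgroup, mul_comm,
      Nat.card_congr (QuotientAddGroup.quotientKerEquivRange φ).toEquiv]
  have h2 : Nat.card φ.range ≤ Nat.card ((DistribSMul.toAddMonoidHom G (p ^ i)).ker) :=
    Nat.card_le_card_of_injective _ Subtype.val_injective
  rw [h1]
  exact Nat.mul_le_mul hker h2

/-- `#G[p^i] ≤ p^i`. [folklore] -/
private theorem card_tors_pow_le (hcyc : Nat.card {x : G // p • x = 0} ≤ p) (i : ℕ) :
    Nat.card ((DistribSMul.toAddMonoidHom G (p ^ i)).ker) ≤ p ^ i := by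
  induction i with
  | zero =>
    have h : (DistribSMul.toAddMonoidHom G (p ^ 0)).ker = ⊥ := by
      ext x
      rw [mem_tors, pow_zero, one_smul, AddSubgroup.mem_bot]
    rw [h, AddSubgroup.card_bot, pow_zero]
  | succ i ih =>
    refine (card_tors_succ_le hcyc i).trans ?_
    rw [pow_succ']
    exact Nat.mul_le_mul_left _ ih

variable [hp : Fact p.Prime]

/-- `#G[p^e] = p^e` for `e = v_p #G`: `#G = #G[p^e] · #(p^e G)` and `p ∤ #(p^e G)` (an element
`p^e • w` of order `p` would have `v_p(ord) + e ≤ e`, §1). [folklore] -/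
private theorem card_tors_eq (hcyc : Nat.card {x : G // p • x = 0} ≤ p) :
    Nat.card (DistribSMul.toAddMonoidHom G (p ^ padicValNat p (Nat.card G))).ker =
      p ^ padicValNat p (Nat.card G) := by
  set e := padicValNat p (Nat.card G) with he
  let ψ : G →+ G := DistribSMul.toAddMonoidHom G (p ^ e)
  have hG : Nat.card G =
      Nat.card ((DistribSMul.toAddMonoidHom G (p ^ e)).ker) * Nat.card ψ.range := by
    rw [ψ.ker.card_eq_card_quotient_mul_card_addSubgroup, mul_comm,
      Nat.card_congr (QuotientAddGroup.quotientKerEquivRange ψ).toEquiv]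
  have hndvd : ¬ p ∣ Nat.card ψ.range := by
    intro hdvd
    obtain ⟨z, hz⟩ := exists_prime_addOrderOf_dvd_card' p hdvd
    obtain ⟨w, hw⟩ := AddMonoidHom.mem_range.mp z.2
    have hzG : addOrderOf (z : G) = p := by rw [AddSubgroup.addOrderOf_coe, hz]
    have hle := padicValNat_addOrderOf_add_le_of_pow_smul_eq (G := G) (p := p) (j := e)
      (x := (z : G)) (y := w) le_rfl hw
    rw [hzG, padicValNat_self] at hle
    omega
  have hcop : Nat.Coprime (p ^ e) (Nat.card ψ.range) :=
    Nat.Coprime.pow_left _ ((Nat.Prime.coprime_iff_not_dvd hp.out).mpr hndvd)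
  have hdvd : p ^ e ∣ Nat.card ((DistribSMul.toAddMonoidHom G (p ^ e)).ker) := by
    have h : p ^ e ∣ Nat.card ((DistribSMul.toAddMonoidHom G (p ^ e)).ker) * Nat.card ψ.range := by
      rw [← hG]
      exact pow_padicValNat_dvd
    exact hcop.dvd_of_dvd_mul_right h
  exact le_antisymm (card_tors_pow_le hcyc e) (Nat.le_of_dvd Nat.card_pos hdvd)

/-- With `#G[p] ≤ p` and `e = v_p #G ≥ 1`: `G[p^e]` is cyclic, generated by an element of order `p^e`.
[folklore] -/
private theorem exists_tors_eq_zmultiples (hcyc : Nat.card {x : G // p • x = 0} ≤ p)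
    (he : 1 ≤ padicValNat p (Nat.card G)) :
    ∃ w : G, addOrderOf w = p ^ padicValNat p (Nat.card G) ∧
      (DistribSMul.toAddMonoidHom G (p ^ padicValNat p (Nat.card G))).ker =
        AddSubgroup.zmultiples w := by
  set e := padicValNat p (Nat.card G) with he'
  have hle : (DistribSMul.toAddMonoidHom G (p ^ (e - 1))).ker ≤
      (DistribSMul.toAddMonoidHom G (p ^ e)).ker := fun x hx => by
    rw [mem_tors] at hx ⊢
    rw [← Nat.sub_add_cancel he, pow_succ', ← smul_smul, hx, smul_zero]
  have hlt : (DistribSMul.toAddMonoidHom G (p ^ (e - 1))).ker <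
      (DistribSMul.toAddMonoidHom G (p ^ e)).ker := by
    refine lt_of_le_of_ne hle fun h => ?_
    have h1 := card_tors_pow_le hcyc (e - 1)
    rw [h, card_tors_eq hcyc] at h1
    exact absurd h1 (not_le.mpr (Nat.pow_lt_pow_right hp.out.one_lt (by omega)))
  obtain ⟨w, hw1, hw2⟩ := SetLike.exists_of_lt hlt
  rw [mem_tors] at hw1 hw2
  have hord : addOrderOf w = p ^ e := by
    have h := addOrderOf_eq_prime_pow (p := p) (n := e - 1) (x := w) hw2
      (by rw [Nat.sub_add_cancel he]; exact hw1)
    rwa [Nat.sub_add_cancel he] at h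
  refine ⟨w, hord, ?_⟩
  symm
  apply AddSubgroup.eq_of_le_of_card_ge
  · rw [AddSubgroup.zmultiples_le, mem_tors]
    exact hw1
  · rw [card_tors_eq hcyc, Nat.card_zmultiples, hord]

/-- **The cyclic case.** In a finite abelian group `G` with `#G[p] ≤ p` (cyclic `p`-Sylow subgroup):
if `v_p(ord x) + j ≤ e = v_p #G` then `x ∈ p^j G`. With §1 this says: the largest `j ≤ e` with
`x ∈ p^j G` is EXACTLY `e − v_p(ord x)`. [folklore] -/
theorem exists_pow_smul_eq_of_padicValNat_addOrderOf_add_le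
    (hcyc : Nat.card {x : G // p • x = 0} ≤ p) {j : ℕ} {x : G}
    (h : padicValNat p (addOrderOf x) + j ≤ padicValNat p (Nat.card G)) :
    ∃ y : G, p ^ j • y = x := by
  set e := padicValNat p (Nat.card G) with he'
  rcases Nat.eq_zero_or_pos j with rfl | hj
  · exact ⟨x, by rw [pow_zero, one_smul]⟩
  have he : 1 ≤ e := by omega
  obtain ⟨w, hw, hT⟩ := exists_tors_eq_zmultiples hcyc he
  -- `ord x = p^v · b`, `p ∤ b`
  set N := addOrderOf x with hN
  have hN0 : N ≠ 0 := (addOrderOf_pos x).ne'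
  set v := padicValNat p N with hv
  obtain ⟨b, hb⟩ : p ^ v ∣ N := pow_padicValNat_dvd
  have hpb : ¬ p ∣ b := by
    intro hpb
    have hdiv : p ^ (v + 1) ∣ N := by
      rw [hb, pow_succ]
      exact mul_dvd_mul_left _ hpb
    exact pow_succ_padicValNat_not_dvd hN0 hdiv
  -- `b • x ∈ G[p^v] ⊆ G[p^e] = ℤ w`
  have hvx : p ^ v • b • x = 0 := by
    rw [smul_smul, ← hb]
    exact addOrderOf_nsmul_eq_zero x
  have hex : b • x ∈ (DistribSMul.toAddMonoidHom G (p ^ e)).ker := by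
    rw [mem_tors]
    have hve : v ≤ e := by omega
    rw [← Nat.sub_add_cancel hve, pow_add, ← smul_smul, hvx, smul_zero]
  rw [hT, AddSubgroup.mem_zmultiples_iff] at hex
  obtain ⟨t, ht⟩ := hex
  -- `p^v • t • w = 0` forces `p^(e - v) ∣ t`
  have hpt : ((p ^ e : ℕ) : ℤ) ∣ (p ^ v : ℕ) * t := by
    rw [← hw, addOrderOf_dvd_iff_zsmul_eq_zero, mul_smul, ht, natCast_zsmul, hvx]
  obtain ⟨t', ht'⟩ : ((p ^ (e - v) : ℕ) : ℤ) ∣ t := by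
    have hve : v ≤ e := by omega
    have hsplit : ((p ^ e : ℕ) : ℤ) = (p ^ v : ℕ) * (p ^ (e - v) : ℕ) := by
      rw [← Nat.cast_mul, ← pow_add, Nat.add_sub_cancel' hve]
    rw [hsplit] at hpt
    exact (mul_dvd_mul_iff_left (by exact_mod_cast pow_ne_zero v hp.out.ne_zero)).mp hpt
  -- so `b • x = p^j • y₁`
  have hjv : j ≤ e - v := by omega
  obtain ⟨y₁, hy₁⟩ : ∃ y₁ : G, p ^ j • y₁ = b • x := by
    refine ⟨(p ^ (e - v - j)) • t' • w, ?_⟩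
    rw [smul_smul, ← pow_add, Nat.add_sub_cancel' hjv, ← ht, ht', mul_smul, natCast_zsmul]
  -- Bezout for `gcd(b, p^j) = 1`: `x = γ • (b • x) + δ • (p^j • x)`
  have hcop : Nat.Coprime b (p ^ j) :=
    Nat.Coprime.pow_right _ ((Nat.Prime.coprime_iff_not_dvd hp.out).mpr hpb).symm
  have hbez : (b : ℤ) * Nat.gcdA b (p ^ j) + (p ^ j : ℕ) * Nat.gcdB b (p ^ j) = 1 := by
    rw [← Nat.gcd_eq_gcd_ab, hcop.gcd_eq_one, Nat.cast_one]
  refine ⟨Nat.gcdA b (p ^ j) • y₁ + Nat.gcdB b (p ^ j) • x, ?_⟩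
  calc p ^ j • (Nat.gcdA b (p ^ j) • y₁ + Nat.gcdB b (p ^ j) • x)
      = Nat.gcdA b (p ^ j) • (p ^ j • y₁) + Nat.gcdB b (p ^ j) • (p ^ j • x) := by
        rw [smul_add, smul_comm _ (Nat.gcdA b (p ^ j)), smul_comm _ (Nat.gcdB b (p ^ j))]
    _ = ((b : ℤ) * Nat.gcdA b (p ^ j) + (p ^ j : ℕ) * Nat.gcdB b (p ^ j)) • x := by
        rw [hy₁, add_smul, mul_comm (b : ℤ), mul_comm ((p ^ j : ℕ) : ℤ), mul_smul, mul_smul,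
          natCast_zsmul, natCast_zsmul]
    _ = x := by rw [hbez, one_smul]

/-- **The divisibility exponent in the cyclic case: the largest `j ≤ e = v_p #G` with `x ∈ p^j G` is
`e − v_p(ord x)`** (`#G[p] ≤ p`). [folklore] -/
theorem findGreatest_pow_smul_eq_sub_padicValNat_addOrderOf
    (hcyc : Nat.card {x : G // p • x = 0} ≤ p) (x : G) :
    Nat.findGreatest (fun j => ∃ y : G, p ^ j • y = x) (padicValNat p (Nat.card G)) =
      padicValNat p (Nat.card G) - padicValNat p (addOrderOf x) := by
  have hle := findGreatest_pow_smul_add_padicValNat_addOrderOf_le (p := p) x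
  refine le_antisymm (by omega) (Nat.le_findGreatest (Nat.sub_le _ _) ?_)
  exact exists_pow_smul_eq_of_padicValNat_addOrderOf_add_le hcyc (by omega)

end Cyclic

end Summit.BirchSwinnertonDyer.Rank1Residual.Ordinary

end
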